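import Summits.AtomisticToContinuum.Crystallization.Theorems.FreeSplittingCertificatesStrictSplittingRuleCoreJointDefs
import Summits.AtomisticToContinuum.Crystallization.Theorems.FreeSplittingCertificatesStrictSplittingRuleCoreStarSite
import Summits.AtomisticToContinuum.Crystallization.Theorems.FreeSplittingCertificatesStrictSplittingRuleCoreFirstOrderDesignGeometry

/-!
# `StrictSplittingRule` (stmt-AtomisticToContinuum-12560), line `registered`: Bravais covariance and the two-site reduction for the JOINT certificate (reshape r6, lead c5)

Route `FreeSplittingCertificates`, crux r3 `StrictSplittingRule`, line `registered`.  The joint first+second-order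
certificate H12⋆ = `CoreJointCoercive a h κ₁ κ₃` (…CoreJointDefs.lean) asks, for ONE covariant table `(Y₁, β, Y₂, M, N)`,
H1's first-order identity and the co-rotated sitewise inequality `CoreJointSiteIneq … u p` at EVERY site `p` for every
finitely supported `u`.  As for H2⋆ (…CoreStarSite.lean), translating `u` by an even-layer index `g` moves both the
identity and the inequality from `p` to `p + g` (`coreJoint_identity_translate`, `coreJointSiteIneq_translate`), so a
certificate needs them only at the two sublattice representatives `(0,0,0)` and `(1,0,0)`
(`coreJointCoercive_of_two_sites`, registered anchor `stub_coreJointTwoSites`).  Line-internal bookkeeping ([folklore]).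
-/

noncomputable section

namespace Summit.AtomisticToContinuum.Crystallization.Theorems.StrictSplittingRuleBirth

open scoped BigOperators Classical
open Literature.MathematicalPhysics.StatisticalMechanics
open Literature.Geometry.DiscreteGeometry
open Summit.AtomisticToContinuum.Crystallization.Theorems.PalmUnimodularRigidity.LayeredLawsSelectHcp
  (hcpSite ljSqDeriv)

/-- **Bravais covariance of the joint sitewise inequality**: for an even-layer index `g`, the inequality for the
translated field `q ↦ u (q + g)` at `p` is the inequality for `u` at `p + g` (same skew `W`; every series re-indexed by
`q ↦ q + g`). [folklore] -/
theorem coreJointSiteIneq_translate {a h κ₁ κ₃ : ℝ} {Y₁ : Finset (ℤ × ℤ × ℤ)}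
    {β : Bool → (ℤ × ℤ × ℤ) → (ℤ × ℤ × ℤ) → ℝ} {Y₂ : Finset (ℤ × ℤ × ℤ)}
    {M N : Bool → (ℤ × ℤ × ℤ) → (ℤ × ℤ × ℤ) → (ℤ × ℤ × ℤ) → ℝ}
    {u : ℤ × ℤ × ℤ → EuclideanSpace ℝ (Fin 3)} {p g : ℤ × ℤ × ℤ} (hg : Even g.1) :
    CoreJointSiteIneq a h κ₁ κ₃ Y₁ β Y₂ M N (fun q => u (q + g)) p ↔
      CoreJointSiteIneq a h κ₁ κ₃ Y₁ β Y₂ M N u (p + g) := by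
  unfold CoreJointSiteIneq
  have e : ∀ f : ℤ × ℤ × ℤ → ℝ, ∑' q, f q = ∑' q, f (q + g) := fun f => ((Equiv.addRight g).tsum_eq f).symm
  -- least-squares clause: both tsums (for W and W') ; κ₁, κ₃, readout-form, bare, transfer tsums
  conv_rhs => enter [1, W, 2, 1, W', hW', 1]; rw [e]
  conv_rhs => enter [1, W, 2, 1, W', hW', 2]; rw [e]
  conv_rhs => enter [1, W, 2, 2, 1, 1, 1, 2]; rw [e]
  conv_rhs => enter [1, W, 2, 2, 1, 1, 2, 2]; rw [e]
  conv_rhs => enter [1, W, 2, 2, 1, 2]; rw [e]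
  conv_rhs => enter [1, W, 2, 2, 2, 1]; rw [e]
  conv_rhs => enter [1, W, 2, 2, 2, 2]; rw [e]
  simp only [coreStarSite_sub_translate a h hg, Prod.fst_add,
    coreStarSite_parity_translate hg, add_sub_add_right_eq_sub, add_left_inj, add_right_comm _ g]

/-- **Bravais covariance of H1's first-order identity** (the left-hand side as a function of the site): translating `u`
by an even-layer `g` moves it from `p` to `p + g`. [folklore] -/
theorem coreJoint_identity_translate {a h : ℝ} {Y₁ : Finset (ℤ × ℤ × ℤ)}
    {β : Bool → (ℤ × ℤ × ℤ) → (ℤ × ℤ × ℤ) → ℝ}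
    {u : ℤ × ℤ × ℤ → EuclideanSpace ℝ (Fin 3)} {p g : ℤ × ℤ × ℤ} (hg : Even g.1) :
    (∑' q : ℤ × ℤ × ℤ, (if q = p then (0 : ℝ) else
        ljSqDeriv (‖hcpSite a h q - hcpSite a h p‖ ^ 2) *
          inner ℝ (hcpSite a h q - hcpSite a h p) ((fun q => u (q + g)) q - (fun q => u (q + g)) p))) +
      (∑' q : ℤ × ℤ × ℤ, (if q = p then (0 : ℝ) else
        ∑ s ∈ Y₁, (β (decide (Even p.1)) (q - p) s *
            inner ℝ (hcpSite a h (p + s) - hcpSite a h p) ((fun q => u (q + g)) (p + s) - (fun q => u (q + g)) p) -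
          β (decide (Even q.1)) (p - q) s *
            inner ℝ (hcpSite a h (q + s) - hcpSite a h q) ((fun q => u (q + g)) (q + s) - (fun q => u (q + g)) q)))) =
    (∑' q : ℤ × ℤ × ℤ, (if q = p + g then (0 : ℝ) else
        ljSqDeriv (‖hcpSite a h q - hcpSite a h (p + g)‖ ^ 2) *
          inner ℝ (hcpSite a h q - hcpSite a h (p + g)) (u q - u (p + g)))) +
      (∑' q : ℤ × ℤ × ℤ, (if q = p + g then (0 : ℝ) else
        ∑ s ∈ Y₁, (β (decide (Even (p + g).1)) (q - (p + g)) s *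
            inner ℝ (hcpSite a h (p + g + s) - hcpSite a h (p + g)) (u (p + g + s) - u (p + g)) -
          β (decide (Even q.1)) (p + g - q) s *
            inner ℝ (hcpSite a h (q + s) - hcpSite a h q) (u (q + s) - u q)))) := by
  have e : ∀ f : ℤ × ℤ × ℤ → ℝ, ∑' q, f q = ∑' q, f (q + g) := fun f => ((Equiv.addRight g).tsum_eq f).symm
  conv_rhs => enter [1]; rw [e]
  conv_rhs => enter [2]; rw [e]
  simp only [coreStarSite_sub_translate a h hg, Prod.fst_add,
    coreStarSite_parity_translate hg, add_sub_add_right_eq_sub, add_left_inj, add_right_comm _ g]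

/-- **Two sites suffice for the joint certificate**: a covariant decaying table `(Y₁, β, Y₂, M, N)` for which H1's
identity and the joint sitewise inequality hold at the two sublattice representatives `(0,0,0)` and `(1,0,0)`, for every
finitely supported `u`, proves H12⋆ — every other site is an even-layer translate of one of them. [folklore] -/
theorem coreJointCoercive_of_two_sites {a h κ₁ κ₃ : ℝ}
    (hcert : ∃ (C : ℝ) (Y₁ : Finset (ℤ × ℤ × ℤ)) (β : Bool → (ℤ × ℤ × ℤ) → (ℤ × ℤ × ℤ) → ℝ)
        (Y₂ : Finset (ℤ × ℤ × ℤ)) (M N : Bool → (ℤ × ℤ × ℤ) → (ℤ × ℤ × ℤ) → (ℤ × ℤ × ℤ) → ℝ),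
        (∀ b d s, s ∉ Y₁ → β b d s = 0) ∧
        (∀ p q : ℤ × ℤ × ℤ, ∀ s, |β (decide (Even p.1)) (q - p) s| ≤
            C * ((1 + ‖hcpSite a h q - hcpSite a h p‖)⁻¹) ^ 6) ∧
        (∀ b d s s', s ∉ Y₂ ∨ s' ∉ Y₂ → M b d s s' = 0 ∧ N b d s s' = 0) ∧
        (∀ p q : ℤ × ℤ × ℤ, ∀ s s', |M (decide (Even p.1)) (q - p) s s'| ≤
            C * ((1 + ‖hcpSite a h q - hcpSite a h p‖)⁻¹) ^ 6 ∧
          |N (decide (Even p.1)) (q - p) s s'| ≤ C * ((1 + ‖hcpSite a h q - hcpSite a h p‖)⁻¹) ^ 6) ∧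
        ∀ u : ℤ × ℤ × ℤ → EuclideanSpace ℝ (Fin 3), (Function.support u).Finite →
          ∀ p ∈ ({(0, 0, 0), (1, 0, 0)} : Finset (ℤ × ℤ × ℤ)),
            ((∑' q : ℤ × ℤ × ℤ, (if q = p then (0 : ℝ) else
                ljSqDeriv (‖hcpSite a h q - hcpSite a h p‖ ^ 2) *
                  inner ℝ (hcpSite a h q - hcpSite a h p) (u q - u p))) +
              (∑' q : ℤ × ℤ × ℤ, (if q = p then (0 : ℝ) else
                ∑ s ∈ Y₁, (β (decide (Even p.1)) (q - p) s *
                    inner ℝ (hcpSite a h (p + s) - hcpSite a h p) (u (p + s) - u p) -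
                  β (decide (Even q.1)) (p - q) s *
                    inner ℝ (hcpSite a h (q + s) - hcpSite a h q) (u (q + s) - u q)))) = 0) ∧
            CoreJointSiteIneq a h κ₁ κ₃ Y₁ β Y₂ M N u p) :
    CoreJointCoercive a h κ₁ κ₃ := by
  obtain ⟨C, Y₁, β, Y₂, M, N, hY₁, hβ, hY₂, hMN, hc⟩ := hcert
  have key : ∀ u : ℤ × ℤ × ℤ → EuclideanSpace ℝ (Fin 3), (Function.support u).Finite → ∀ p : ℤ × ℤ × ℤ,
      ((∑' q : ℤ × ℤ × ℤ, (if q = p then (0 : ℝ) else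
          ljSqDeriv (‖hcpSite a h q - hcpSite a h p‖ ^ 2) *
            inner ℝ (hcpSite a h q - hcpSite a h p) (u q - u p))) +
        (∑' q : ℤ × ℤ × ℤ, (if q = p then (0 : ℝ) else
          ∑ s ∈ Y₁, (β (decide (Even p.1)) (q - p) s *
              inner ℝ (hcpSite a h (p + s) - hcpSite a h p) (u (p + s) - u p) -
            β (decide (Even q.1)) (p - q) s *
              inner ℝ (hcpSite a h (q + s) - hcpSite a h q) (u (q + s) - u q)))) = 0) ∧
      CoreJointSiteIneq a h κ₁ κ₃ Y₁ β Y₂ M N u p := by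
    intro u hu p
    rcases Int.even_or_odd p.1 with hp | hp
    · have h0 := hc (fun q => u (q + p)) (coreStarSite_support_translate hu p) (0, 0, 0) (by simp)
      have e : ((0, 0, 0) : ℤ × ℤ × ℤ) + p = p := by ext <;> simp
      refine ⟨?_, ?_⟩
      · have := (coreJoint_identity_translate (a := a) (h := h) (Y₁ := Y₁) (β := β) (u := u)
          (p := (0, 0, 0)) (g := p) hp).symm.trans h0.1
        rwa [e] at this
      · have := (coreJointSiteIneq_translate (p := (0, 0, 0)) (g := p) hp).1 h0.2
        rwa [e] at this
    · have hg : Even (p - (1, 0, 0)).1 := by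
        show Even (p.1 - 1)
        obtain ⟨k, hk⟩ := hp
        exact ⟨k, by omega⟩
      have h1 := hc (fun q => u (q + (p - (1, 0, 0)))) (coreStarSite_support_translate hu _) (1, 0, 0) (by simp)
      refine ⟨?_, ?_⟩
      · have := (coreJoint_identity_translate (a := a) (h := h) (Y₁ := Y₁) (β := β) (u := u)
          (p := (1, 0, 0)) (g := p - (1, 0, 0)) hg).symm.trans h1.1
        rwa [add_sub_cancel] at this
      · have := (coreJointSiteIneq_translate (p := (1, 0, 0)) (g := p - (1, 0, 0)) hg).1 h1.2
        rwa [add_sub_cancel] at this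
  exact ⟨C, Y₁, β, Y₂, M, N, hY₁, hβ, hY₂, hMN, fun u hu p => (key u hu p).1, fun u hu p => (key u hu p).2⟩

/-- **Registered anchor `stub_coreJointTwoSites`** (reshape r6): H12⋆ from a two-site joint certificate
(`coreJointCoercive_of_two_sites`, closed form). -/
theorem stub_coreJointTwoSites : ∀ a h κ₁ κ₃ : ℝ,
    (∃ (C : ℝ) (Y₁ : Finset (ℤ × ℤ × ℤ)) (β : Bool → (ℤ × ℤ × ℤ) → (ℤ × ℤ × ℤ) → ℝ)
        (Y₂ : Finset (ℤ × ℤ × ℤ)) (M N : Bool → (ℤ × ℤ × ℤ) → (ℤ × ℤ × ℤ) → (ℤ × ℤ × ℤ) → ℝ),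
        (∀ b d s, s ∉ Y₁ → β b d s = 0) ∧
        (∀ p q : ℤ × ℤ × ℤ, ∀ s, |β (decide (Even p.1)) (q - p) s| ≤
            C * ((1 + ‖hcpSite a h q - hcpSite a h p‖)⁻¹) ^ 6) ∧
        (∀ b d s s', s ∉ Y₂ ∨ s' ∉ Y₂ → M b d s s' = 0 ∧ N b d s s' = 0) ∧
        (∀ p q : ℤ × ℤ × ℤ, ∀ s s', |M (decide (Even p.1)) (q - p) s s'| ≤
            C * ((1 + ‖hcpSite a h q - hcpSite a h p‖)⁻¹) ^ 6 ∧
          |N (decide (Even p.1)) (q - p) s s'| ≤ C * ((1 + ‖hcpSite a h q - hcpSite a h p‖)⁻¹) ^ 6) ∧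
        ∀ u : ℤ × ℤ × ℤ → EuclideanSpace ℝ (Fin 3), (Function.support u).Finite →
          ∀ p ∈ ({(0, 0, 0), (1, 0, 0)} : Finset (ℤ × ℤ × ℤ)),
            ((∑' q : ℤ × ℤ × ℤ, (if q = p then (0 : ℝ) else
                ljSqDeriv (‖hcpSite a h q - hcpSite a h p‖ ^ 2) *
                  inner ℝ (hcpSite a h q - hcpSite a h p) (u q - u p))) +
              (∑' q : ℤ × ℤ × ℤ, (if q = p then (0 : ℝ) else
                ∑ s ∈ Y₁, (β (decide (Even p.1)) (q - p) s *
                    inner ℝ (hcpSite a h (p + s) - hcpSite a h p) (u (p + s) - u p) -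
                  β (decide (Even q.1)) (p - q) s *
                    inner ℝ (hcpSite a h (q + s) - hcpSite a h q) (u (q + s) - u q)))) = 0) ∧
            CoreJointSiteIneq a h κ₁ κ₃ Y₁ β Y₂ M N u p) →
    CoreJointCoercive a h κ₁ κ₃ :=
  fun _ _ _ _ hcert => coreJointCoercive_of_two_sites hcert

end Summit.AtomisticToContinuum.Crystallization.Theorems.StrictSplittingRuleBirth

end
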